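import Summits.BirchSwinnertonDyer.BirchSwinnertonDyer.Theorems.SignedLowerHalvesKobayashiLowerHalfLargeImageKuriharaRigidityThree
import Summits.BirchSwinnertonDyer.Rank1Residual.Supersingular.KobayashiMainConjectureKuriharaRigidityThree
import Summits.BirchSwinnertonDyer.Rank1Residual.Supersingular.GoodSSTowerOfSurj
import HarnessLib

/-!
# Line `kurihara_rigidity` of crux `KobayashiLowerHalfLargeImage` (route `SignedLowerHalves`, item
# stmt-BirchSwinnertonDyer-19001) at `p = 3`: the ENGINE at `3` — «Kim–Kim–Sun 2020 Thm 1.1 ∘ Kobayashi 2003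
# Thm 7.4», binder `KimKimSun2020_thm11_via_kobayashi74_three` — with its tower hypothesis DISCHARGED on the
# good supersingular classes, and `stub_three` / the crux BY NAME with the `p = 3` case on the Kurihara road
# (cell `bsd-ssimc`, seat `bsd-line-slh-p1`, lead gen 2, cycle 2; `--supports` 19001, helper; closes nothing)

HONEST FRAMING: nothing here proves BSD or the crux; compositions BY NAME only; every open input is displayed.
The skeleton of record (reshape r2, registered b8007614) is unchanged; `stub_three` stays registered.

WHAT. The sibling `…KuriharaRigidityThree.lean` (p611193) reduced `stub_three` to {an engine at `3` of the
displayed shape `hE`, Kurihara's conjecture at `3` on a side condition `T`, the crux off `T`} for an ARBITRARY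
`T`. The definition-kind file `Rank1Residual/Supersingular/KobayashiMainConjectureKuriharaRigidityThree.lean`
(p611880) typed the engine's source — Kim–Kim–Sun, Selecta Math. 26 (2020) Thm 1.1, printed for every `p > 2`
(their §8.2.2 is a `p = 3` good-supersingular example), composed with Kobayashi's Thm 7.4 (`p` odd) — as the
binder `KimKimSun2020_thm11_via_kobayashi74_three` (flag `KKS20@3-MR-H4` displayed there), with (Tam)'s first
clause as the predicate `KimKimSun2020TamAt W p` and the `3`-adic tower as an extra hypothesis (reading
`KKS20-tower`). HERE: (§1) the tower is a THEOREM at a good supersingular `3` from `ρ̄_{E,3}` onto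
(`GoodSS.towerSurj_of_surj`: Wuthrich 2014 Lemma 20 + Kato's (12.5.2)), so the binder yields the engine in
EXACTLY the shape `hE` (`signedMC_of_kuriharaUnit_three`); (§2) `stub_three`'s registered statement from {the
binder, the `p = 3` period fact, Kurihara's conjecture at `3` on the rows X7 ∧ ¬CM ∧ `a₃ = 0` ∧ Surj ∧ (Tam) ∧
`3 ∤ ∏ c_ℓ`, the crux at the X7@3 pairs OFF those rows} — the side condition of the generic composition is taken
to be `T W p := KimKimSun2020TamAt W p ∧ ¬ p ∣ W.tamagawaProduct`: the Tamagawa clause is NOT needed by the engine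
(KKS: automatic under a unit Kurihara number) but IS needed for Kurihara's conjecture to be plausible — with a
Tamagawa defect at `3` every Kurihara number vanishes mod `3` (Kim AJM 2026 Remark 6.2; KKS Remark 2.3), so those
rows (no engine at `3` even in preprint form: Castella–Sano is `p > 3`) belong to the honest residue `hR` —; and
the crux BY NAME accordingly; (§3) the per-pair X7@3 consumers (one unit Kurihara number at a cyclic level ⟹ BOTH
signed main conjectures at `3`).

NET EFFECT ON THE LINE (honest): the `p = 3` residue is no longer «engine-free» — modulo ONE displayed PUBLISHED
binder (with its flag) and the `p = 3` period fact, it has the same shape as the `p ≥ 5`, `t = 0` regime: a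
Σ⁰₁ certificate per pair (`X4.KuriharaUnitAt W 3 f`) on the rows with (Tam) and `3 ∤ ∏ c_ℓ`, plus an explicit
smaller residue (X7@3 pairs with a split multiplicative `q ≡ 1 (3)`, a non-split multiplicative `q ≡ 2 (3)`, or
`3 ∣ ∏ c_ℓ`). What it does NOT do: prove Kurihara's conjecture at `3` for any pair (no computation here), resolve
the flag, or touch `p ≥ 5`. Reading `KKS20-Tam2` (for a disprover): if KKS's second clause (`ord_q N(ρ̄) = ord_q N`,
i.e. `3 ∤ #Φ_q(𝔽̄_q)`) matters beyond `3 ∤ c_q`, a pair with `3 ∣ #Φ_q(𝔽̄_q)`, `3 ∤ c_q` (a IV* fibre with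
non-rational components) would falsify `hU` as displayed and move to the residue; no such claim is made here.

References: [KimKimSun2020] Thm 1.1, (Tam) p. 4, Rem 2.3, §8.2.2; [Kobayashi2003] Thm 7.4 (p. 13); [Wuthrich2014]
Lemma 20; [Kato2004Asterisque] (12.5.2); [GreenbergVatsal2000] Rem 3.4; [Mazur1978] Cor 4.1; [Kim2022StructureSelmer]
Thm 1.11; [CastellaSano2026] Thm 1 (PRE).
-/

set_option autoImplicit false

set_option linter.dupNamespace false

noncomputable section

open scoped Classical MatrixGroups ModularForm

open CongruenceSubgroup WeierstrassCurve Literature.NumberTheory.EllipticCurves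
  Literature.NumberTheory.EllipticCurves.ModularForms
  Literature.NumberTheory.EllipticCurves.Rank1Residual
  Literature.NumberTheory.EllipticCurves.Rank1Residual.Typed
  Summit.BirchSwinnertonDyer.Rank1Residual.Supersingular
  Summit.BirchSwinnertonDyer.Rank1Residual.X4

namespace Summit.BirchSwinnertonDyer.BirchSwinnertonDyer.Theorems.KuriharaRigidity

/-! ### §1 The engine at `3` in the shape `hE`, tower discharged -/

/-- **ENGINE at `p = 3` of line `kurihara_rigidity`** — GRANTED the binder `KimKimSun2020_thm11_via_kobayashi74_three`
(`hKKS`: KKS 2020 Thm 1.1 at `3` ∘ Kobayashi 7.4, PUBLISHED ×2, flag `KKS20@3-MR-H4`) and the `p = 3` period fact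
`realPeriodRat_eq_unit_mul_plusPeriod_three` (`h3`): at `p = 3` of good reduction with `a₃ = 0`, `ρ̄_{W,3}` onto and
(Tam)'s first clause, a unit Kurihara number at a cyclic Kolyvagin level for every newform of `W` gives
`KobayashiMainConjecture W 3 ε` for EVERY sign. The binder's tower hypothesis is discharged by
`GoodSS.towerSurj_of_surj` (good supersingular: `3 ∣ a₃ = 0`); its period clause by `h3` with `E[3]` irreducible
from `ρ̄` onto; the newform is supplied by the main conjecture's own binders. Exactly the shape `hE` of
`three_of_engine_of_unit_of_offSide` with `T := KimKimSun2020TamAt`. CONDITIONAL; closes nothing.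
[cite: KimKimSun2020, Thm. 1.1 and §8.2.2] [cite: Kobayashi2003, Thm. 7.4 (p. 13)] [cite: Wuthrich2014, Lemma 20 (p. 399)] -/
theorem signedMC_of_kuriharaUnit_three (hKKS : KimKimSun2020_thm11_via_kobayashi74_three)
    (h3 : realPeriodRat_eq_unit_mul_plusPeriod_three) :
    ∀ (W : WeierstrassCurve ℚ) [W.IsElliptic] [W.IsGloballyMinimal] (p : ℕ) [Fact p.Prime],
      p = 3 → W.HasGoodReductionAtPrime p → W.frobeniusTrace p = 0 → Surj W p → KimKimSun2020TamAt W p →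
      (∀ [NeZero (W.conductorNorm ℤ)] (f : CuspForm (Gamma0 (W.conductorNorm ℤ)) 2),
          IsNewformOf W f → KuriharaUnitAt W p f) →
      ∀ ε : ℤˣ, KobayashiMainConjecture W p ε := by
  intro W _ _ p _ hp3 hgood hap hs htam hcert ε κ γ hκ hγ hγ' _ f hf
  have hss : GoodSS W p := ⟨hgood, by rw [hap]; exact dvd_zero _⟩
  have hp2 : p ≠ 2 := by omega
  exact kobayashiMainConjecture_three_of_kuriharaUnitAt W p hKKS h3 hp3 hgood hap hs
    (GoodSS.towerSurj_of_surj W p hp2 hss hs) htam f hf (hcert f hf) ε κ γ hκ hγ hγ' f hf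

/-! ### §2 `stub_three` and the crux BY NAME with the `p = 3` case on the Kurihara road -/

/-- **`stub_three` (its registered statement, verbatim) from the KKS@3 binder, the `p = 3` period fact,
Kurihara's conjecture at `3` on the (Tam)-rows of the corner, and the crux at the X7@3 pairs failing (Tam).**
`hU` = «for `W` in X7 at `3`, non-CM, `a₃ = 0`, `ρ̄_{W,3}` onto, (Tam)'s first clause AND `3 ∤ ∏ c_ℓ`: every
newform of `W` has a unit Kurihara number at a cyclic Kolyvagin level (`X4.KuriharaUnitAt W 3 f`)» — Kurihara's
conjecture (Kim Conj. 1.10 at `t = 0`) read at `p = 3`, Σ⁰₁ per pair (with a Tamagawa defect at `3` every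
Kurihara number vanishes, Kim AJM 2026 Rem. 6.2, whence the Tamagawa clause); `hR` = the crux's own conclusion at
the remaining X7@3 pairs — a split multiplicative prime `q ≡ 1 (mod 3)`, a non-split one `q ≡ −1 (mod 3)`, or
`3 ∣ ∏ c_ℓ` (the honest residue of this road: no engine at `3` there, Castella–Sano being `p > 3`). CONDITIONAL;
closes nothing. [cite: Kim2022StructureSelmer, Remark 6.2 (PDF p. 31)] [cite: KimKimSun2020, Thm. 1.1, (Tam) p. 4] [cite: Kobayashi2003, Thm. 7.4 (p. 13)] -/
theorem stub_three_of_kks_of_kuriharaUnit_of_offTam (hKKS : KimKimSun2020_thm11_via_kobayashi74_three)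
    (h3 : realPeriodRat_eq_unit_mul_plusPeriod_three)
    (hU : ∀ (W : WeierstrassCurve ℚ) [W.IsElliptic] [W.IsGloballyMinimal] (p : ℕ) [Fact p.Prime],
      p = 3 → ClassX7 W p → ¬ W.HasCM → W.frobeniusTrace p = 0 → Surj W p → KimKimSun2020TamAt W p →
      ¬ p ∣ W.tamagawaProduct →
      ∀ [NeZero (W.conductorNorm ℤ)] (f : CuspForm (Gamma0 (W.conductorNorm ℤ)) 2),
        IsNewformOf W f → KuriharaUnitAt W p f)
    (hR : ∀ (W : WeierstrassCurve ℚ) [W.IsElliptic] [W.IsGloballyMinimal] (p : ℕ) [Fact p.Prime],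
      p = 3 → ClassX7 W p → ¬ W.HasCM → W.frobeniusTrace p = 0 → Surj W p →
      ¬ (KimKimSun2020TamAt W p ∧ ¬ p ∣ W.tamagawaProduct) →
      ∃ ε : ℤˣ, KobayashiLowerDivisibility W p ε) :
    ∀ (W : WeierstrassCurve ℚ) [W.IsElliptic] [W.IsGloballyMinimal] (p : ℕ) [Fact p.Prime],
      p = 3 → ClassX7 W p → ¬ W.HasCM → W.frobeniusTrace p = 0 → Surj W p →
      ∃ ε : ℤˣ, KobayashiLowerDivisibility W p ε :=
  three_of_engine_of_unit_of_offSide (fun W p => KimKimSun2020TamAt W p ∧ ¬ p ∣ W.tamagawaProduct)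
    (fun W _ _ p _ hp3 hgood hap hs hT hcert =>
      signedMC_of_kuriharaUnit_three hKKS h3 W p hp3 hgood hap hs hT.1 hcert)
    (fun W _ _ p _ hp3 hX hcm hap hs hT _ f hf => hU W p hp3 hX hcm hap hs hT.1 hT.2 f hf) hR

/-- **The crux BY NAME with its `p = 3` case on the Kurihara road, every engine a named binder**: crux ⟸ {Kim
1.11 ∘ Ko 7.4 (PUB, `hKK`), CS Thm 1 ∘ Ko 7.4 (PRE, `hCS`), CS §2 `≥` reading (PRE, `hCSge`), GV period at `p ≥ 5`
(PUB, `h5`), KKS Thm 1.1 at `3` ∘ Ko 7.4 (PUB, flag `KKS20@3-MR-H4`, `hKKS`), period at `3` (PUB, `h3`)} + the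
OPEN statements {`≤` half of Kim's Conj. 1.10 on X7 ∧ ¬CM ∧ Surj ∧ `p ≥ 5` (`hLe`), Kurihara's conjecture at `3`
on the rows X7@3 ∧ ¬CM ∧ Surj ∧ (Tam) ∧ `3 ∤ ∏ c_ℓ` (`hU`), the crux at the other X7@3 pairs (`hR`)}. CONDITIONAL;
closes nothing; BSD is not proved by this. [cite: Kim2022StructureSelmer, Thm. 1.11] [claim: CastellaSano2026, status: under-review]
[cite: KimKimSun2020, Thm. 1.1] [cite: Kobayashi2003, Thm. 7.4 (p. 13)] -/
theorem kobayashiLowerHalfLargeImage_of_readings_of_kks_OPEN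
    (hKK : Kim2026_thm111_via_kobayashi74) (hCS : CastellaSano2026_thm1_via_kobayashi74_OPEN)
    (hCSge : CastellaSano2026_sec2_tamagawaDefectGe_implicit_OPEN) (h5 : realPeriodRat_eq_unit_mul_plusPeriod)
    (hKKS : KimKimSun2020_thm11_via_kobayashi74_three) (h3 : realPeriodRat_eq_unit_mul_plusPeriod_three)
    (hLe : ∀ (W : WeierstrassCurve ℚ) [W.IsElliptic] [W.IsGloballyMinimal] (p : ℕ) [Fact p.Prime],
      5 ≤ p → ClassX7 W p → ¬ W.HasCM → W.frobeniusTrace p = 0 → Surj W p →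
      ∀ [NeZero (W.conductorNorm ℤ)] (f : CuspForm (Gamma0 (W.conductorNorm ℤ)) 2),
        IsNewformOf W f → KimTamagawaDefectLeAt W p f)
    (hU : ∀ (W : WeierstrassCurve ℚ) [W.IsElliptic] [W.IsGloballyMinimal] (p : ℕ) [Fact p.Prime],
      p = 3 → ClassX7 W p → ¬ W.HasCM → W.frobeniusTrace p = 0 → Surj W p → KimKimSun2020TamAt W p →
      ¬ p ∣ W.tamagawaProduct →
      ∀ [NeZero (W.conductorNorm ℤ)] (f : CuspForm (Gamma0 (W.conductorNorm ℤ)) 2),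
        IsNewformOf W f → KuriharaUnitAt W p f)
    (hR : ∀ (W : WeierstrassCurve ℚ) [W.IsElliptic] [W.IsGloballyMinimal] (p : ℕ) [Fact p.Prime],
      p = 3 → ClassX7 W p → ¬ W.HasCM → W.frobeniusTrace p = 0 → Surj W p →
      ¬ (KimKimSun2020TamAt W p ∧ ¬ p ∣ W.tamagawaProduct) →
      ∃ ε : ℤˣ, KobayashiLowerDivisibility W p ε) :
    Summit.BirchSwinnertonDyer.BirchSwinnertonDyer.Theses.SignedLowerHalves.KobayashiLowerHalfLargeImage :=
  kobayashiLowerHalfLargeImage_of_kim111_of_castellaSano_readings_OPEN hKK hCS hCSge h5 hLe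
    (stub_three_of_kks_of_kuriharaUnit_of_offTam hKKS h3 hU hR)

/-! ### §3 Per-pair consumers on X7 at `3` -/

section PerPair

variable (W : WeierstrassCurve ℚ) [W.IsElliptic] [W.IsGloballyMinimal] (p : ℕ) [Fact p.Prime]

/-- **At one X7@3 pair with `a₃ = 0`, `ρ̄` onto and (Tam): ONE unit Kurihara number at a cyclic Kolyvagin level
for a newform `f` of `W` (any level) gives Kobayashi's main conjecture at `3` for BOTH signs** — GRANTED `hKKS`
(flag `KKS20@3-MR-H4`) and `h3`; tower by `ClassX7.towerSurj_of_surj`. Per pair; CONDITIONAL; closes nothing.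
[cite: KimKimSun2020, Thm. 1.1 and §8.2.2] [cite: Kobayashi2003, Thm. 7.4 (p. 13)] [cite: Wuthrich2014, Lemma 20 (p. 399)] -/
theorem X7.kobayashiMainConjecture_three_of_kks_of_kuriharaUnitAt
    (hKKS : KimKimSun2020_thm11_via_kobayashi74_three) (h3 : realPeriodRat_eq_unit_mul_plusPeriod_three)
    (hp3 : p = 3) (hX : ClassX7 W p) (hap : W.frobeniusTrace p = 0) (hs : Surj W p)
    (htam : KimKimSun2020TamAt W p) {N : ℕ} [NeZero N] (f : CuspForm (Gamma0 N) 2) (hf : IsNewformOf W f)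
    (hunit : KuriharaUnitAt W p f) (ε : ℤˣ) : KobayashiMainConjecture W p ε :=
  kobayashiMainConjecture_three_of_kuriharaUnitAt W p hKKS h3 hp3 hX.1.1 hap hs
    (ClassX7.towerSurj_of_surj W p (by omega) hX hs) htam f hf hunit ε

/-- **Same pair: the crux's conclusion `KobayashiLowerDivisibility W 3 ε` for every sign** (the main conjecture
implies its Eisenstein half). Per pair; CONDITIONAL; closes nothing.
[cite: KimKimSun2020, Thm. 1.1] [cite: Kobayashi2003, Conjecture (p. 2) and Thm. 7.4 (p. 13)] -/
theorem X7.kobayashiLowerDivisibility_three_of_kks_of_kuriharaUnitAt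
    (hKKS : KimKimSun2020_thm11_via_kobayashi74_three) (h3 : realPeriodRat_eq_unit_mul_plusPeriod_three)
    (hp3 : p = 3) (hX : ClassX7 W p) (hap : W.frobeniusTrace p = 0) (hs : Surj W p)
    (htam : KimKimSun2020TamAt W p) {N : ℕ} [NeZero N] (f : CuspForm (Gamma0 N) 2) (hf : IsNewformOf W f)
    (hunit : KuriharaUnitAt W p f) (ε : ℤˣ) : KobayashiLowerDivisibility W p ε :=
  kobayashiLowerDivisibility_of_mainConjecture
    (X7.kobayashiMainConjecture_three_of_kks_of_kuriharaUnitAt W p hKKS h3 hp3 hX hap hs htam f hf hunit ε)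

end PerPair

end Summit.BirchSwinnertonDyer.BirchSwinnertonDyer.Theorems.KuriharaRigidity
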